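import Literature.AlgebraicGeometry.HodgeTheory.QuaternionicQuarticDoublePlaneIntegral
import Literature.AlgebraicGeometry.HodgeTheory.QuaternionicQuarticDeckChartEtale
import HarnessLib

/-!
# The substitution `u ↦ u(s, y)` of the double-plane chart is injective: `Ψ₂ = ψ(u(s,y), 1) ≠ 0` as soon as `ψ(u, 1) ≠ 0`

Layer `Literature/AlgebraicGeometry/HodgeTheory`. Definitions (the plumbing substitutions `sqExp`, `sqSubst`, `linSubst`,
`linSubstInv`) + proved API; no named fact. Sequel of `QuaternionicQuarticDoublePlaneIntegral` (whose
`hBar_mem_nonZeroDivisors` ∕ `isDomain_doublePlaneRing` ∕ `birationalOver_spec_doublePlane` take `planeH₂ ≠ 0`, reduced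
there to `planeΨ₂ ≠ 0` by `planeH₂_ne_zero`). Written by the prover seat `leafhand-hodge-q8symplecticpowers-4` (g4, cell
`pub-hsemireg`) for route `HodgeConjecture/Q8SymplecticPowers` (crux K1Q, stmt-HodgeConjecture-24190), brick **Zb-3/S1a** of the
S1 programme (`stub_regularVeryGeneralQ`).

The map `γ : R[u₀, u₁] → R[s, y]`, `u ↦ u(s, y)` (the unique `u` with `c(u) = s²y`, `σc(u) = y`) factors as
`γ = sqSubst ∘ linSubst`: `linSubst` is the affine change `u ↦ ((c, σc) ↦ u)`-inverse direction
(`X₀ ↦ dinv·(a₀(X₀ − a₂) − a₁(X₁ − a₂))`, `X₁ ↦ dinv·(a₀(X₁ − a₂) − a₁(X₀ − a₂))`, left-invertible when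
`(a₀² − a₁²)·dinv = 1`: `linSubstInv_linSubst`) and `sqSubst : X₀ ↦ X₀²X₁, X₁ ↦ X₁` sends the monomial `X₀ⁱX₁ʲ` to
`X₀²ⁱX₁ⁱ⁺ʲ` — an injective map on exponents (`sqExp_injective`), hence is injective on polynomials over ANY commutative ring
(`coeff_sqExp_sqSubst`, `sqSubst_injective`). Consequently:

* `planeΨ₂_eq` — `Ψ₂ = sqSubst (linSubst (ψ₂ a))` with the tree's `ψ₂ a = ψ(u₀, u₁, 1)` (`QuaternionicQuarticDeckChartEtale`);
* **`planeΨ₂_ne_zero`** — `(a₀² − a₁²)·dinv = 1` and `ψ₂ a ≠ 0` give `planeΨ₂ a dinv ≠ 0`;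
* **`hBar_mem_nonZeroDivisors'`, `isDomain_doublePlaneRing'`, `birationalOver_spec_doublePlane'`** — the conclusions of
  `QuaternionicQuarticDoublePlaneIntegral` under the tree-vocabulary hypotheses: `R` a domain, `(a₀² − a₁²)·dinv = 1`,
  `dinv ≠ 0`, `a₀ + a₁ ≠ 0`, `ψ₂ a ≠ 0` (all implied at the generic point and at the complex points off a hypersurface).

Honest scope: explicit commutative algebra; nothing here bears on HC; S1 ∕ K1Q NOT proved.

## References

* [AtiyahMacdonald1969] M. F. Atiyah, I. G. Macdonald, Introduction to Commutative Algebra (1969), Ch. 1 Ex. 2–4.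
* [Zariski1929] O. Zariski, On the linear connection index of the algebraic surfaces zⁿ = f(x, y), PNAS 15 (1929).
* [Naie2007] D. Naie, The irregularity of cyclic multiple planes after Zariski, Enseign. Math. 53 (2007), §1.2.
-/

noncomputable section

open MvPolynomial CategoryTheory AlgebraicGeometry

namespace Literature.AlgebraicGeometry.HodgeTheory.Q8Family

universe v

/-! ### The monomial substitution `X₀ ↦ X₀²X₁`, `X₁ ↦ X₁` is injective -/

section Sq

variable {R : Type v} [CommRing R]

/-- The exponent map `(i, j) ↦ (2i, i + j)` of the substitution `X₀ ↦ X₀²X₁`, `X₁ ↦ X₁`.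
[cite: AtiyahMacdonald1969, Ch. 1 Ex. 2–4 (polynomial rings in several variables)] -/
def sqExp (m : Fin 2 →₀ ℕ) : Fin 2 →₀ ℕ :=
  Finsupp.single 0 (2 * m 0) + Finsupp.single 1 (m 0 + m 1)

/-- `sqExp` at the index `0`. [cite: AtiyahMacdonald1969, Ch. 1 Ex. 2–4 (polynomial rings in several variables)] -/
@[simp] theorem sqExp_zero (m : Fin 2 →₀ ℕ) : sqExp m 0 = 2 * m 0 := by
  simp [sqExp]

/-- `sqExp` at the index `1`. [cite: AtiyahMacdonald1969, Ch. 1 Ex. 2–4 (polynomial rings in several variables)] -/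
@[simp] theorem sqExp_one (m : Fin 2 →₀ ℕ) : sqExp m 1 = m 0 + m 1 := by
  simp [sqExp]

/-- The exponent map is injective. [cite: AtiyahMacdonald1969, Ch. 1 Ex. 2–4 (polynomial rings in several variables)] -/
theorem sqExp_injective : Function.Injective (sqExp) := by
  intro m n h
  have h0 := congrArg (fun f => f 0) h
  have h1 := congrArg (fun f => f 1) h
  simp only [sqExp_zero, sqExp_one] at h0 h1
  ext i
  fin_cases i
  · simp only [Fin.zero_eta]; omega
  · simp only [Fin.mk_one]; omega

/-- The substitution `X₀ ↦ X₀²X₁`, `X₁ ↦ X₁` (`(c', y') ↦ (s²y, y)`: the cone chart).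
[cite: AtiyahMacdonald1969, Ch. 1 Ex. 2–4 (polynomial rings in several variables)] -/
def sqSubst (R : Type v) [CommRing R] : MvPolynomial (Fin 2) R →ₐ[R] MvPolynomial (Fin 2) R :=
  aeval ![X 0 ^ 2 * X 1, X 1]

/-- `sqSubst` on `X₀`. [cite: AtiyahMacdonald1969, Ch. 1 Ex. 2–4 (polynomial rings in several variables)] -/
@[simp] theorem sqSubst_X0 : sqSubst R (X 0) = X 0 ^ 2 * X 1 := by simp [sqSubst]
/-- `sqSubst` on `X₁`. [cite: AtiyahMacdonald1969, Ch. 1 Ex. 2–4 (polynomial rings in several variables)] -/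
@[simp] theorem sqSubst_X1 : sqSubst R (X 1) = X 1 := by simp [sqSubst]

/-- `sqSubst` on monomials: `X^m ↦ X^{sqExp m}`. [cite: AtiyahMacdonald1969, Ch. 1 Ex. 2–4 (polynomial rings in several variables)] -/
theorem sqSubst_monomial (m : Fin 2 →₀ ℕ) (r : R) : sqSubst R (monomial m r) = monomial (sqExp m) r := by
  rw [sqSubst, aeval_monomial, Finsupp.prod_fintype _ _ (fun i => by simp), Fin.prod_univ_two]
  simp only [Matrix.cons_val_zero, Matrix.cons_val_one, MvPolynomial.algebraMap_eq]
  have hx : (X 0 ^ 2 * X 1 : MvPolynomial (Fin 2) R) ^ m 0 * X 1 ^ m 1 = monomial (sqExp m) 1 := by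
    rw [X, X]
    simp only [monomial_pow, monomial_mul, one_pow, mul_one]
    rw [monomial_eq_monomial_iff]
    left
    refine ⟨?_, rfl⟩
    ext i
    fin_cases i
    · simp [sqExp]
      ring
    · simp [sqExp]
  rw [hx, C_mul_monomial, mul_one]

/-- Coefficients are transported along `sqExp`: `coeff (sqExp m) (sqSubst p) = coeff m p`.
[cite: AtiyahMacdonald1969, Ch. 1 Ex. 2–4 (polynomial rings in several variables)] -/
theorem coeff_sqExp_sqSubst (p : MvPolynomial (Fin 2) R) (m : Fin 2 →₀ ℕ) :
    coeff (sqExp m) (sqSubst R p) = coeff m p := by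
  induction p using MvPolynomial.induction_on' with
  | monomial n r =>
    rw [sqSubst_monomial, coeff_monomial, coeff_monomial]
    by_cases h : n = m
    · subst h; simp
    · rw [if_neg (fun h' => h (sqExp_injective h')), if_neg h]
  | add p q hp hq => rw [map_add, coeff_add, coeff_add, hp, hq]

/-- **`sqSubst` is injective** over any commutative ring. [cite: AtiyahMacdonald1969, Ch. 1 Ex. 2–4 (polynomial rings in several variables)] -/
theorem sqSubst_injective : Function.Injective (sqSubst R) := by
  intro p q h
  ext m
  rw [← coeff_sqExp_sqSubst p m, ← coeff_sqExp_sqSubst q m, h]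

end Sq

/-! ### The affine change `(c, σc) ↤ u` and the factorisation of `u ↦ u(s, y)` -/

section Lin

variable {R : Type v} [CommRing R] {e : ℕ} (a : CIdx e → R) (dinv : R)

/-- The affine substitution `X₀ ↦ dinv·(a₀(X₀ − a₂) − a₁(X₁ − a₂))`, `X₁ ↦ dinv·(a₀(X₁ − a₂) − a₁(X₀ − a₂))` (the
inverse of `u ↦ (c(u), σc(u))` when `(a₀² − a₁²)dinv = 1`). [cite: Naie2007, §1.2 (normalization procedure) and Example 1] -/
def linSubst : MvPolynomial (Fin 2) R →ₐ[R] MvPolynomial (Fin 2) R :=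
  aeval ![C dinv * (C (coefLin a 0) * (X 0 - C (coefLin a 2)) - C (coefLin a 1) * (X 1 - C (coefLin a 2))),
    C dinv * (C (coefLin a 0) * (X 1 - C (coefLin a 2)) - C (coefLin a 1) * (X 0 - C (coefLin a 2)))]

/-- The substitution `u ↦ (c(u), σc(u))`: `X₀ ↦ a₀X₀ + a₁X₁ + a₂`, `X₁ ↦ a₁X₀ + a₀X₁ + a₂`.
[cite: Naie2007, §1.2 (normalization procedure) and Example 1] -/
def linSubstInv : MvPolynomial (Fin 2) R →ₐ[R] MvPolynomial (Fin 2) R :=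
  aeval ![C (coefLin a 0) * X 0 + C (coefLin a 1) * X 1 + C (coefLin a 2),
    C (coefLin a 1) * X 0 + C (coefLin a 0) * X 1 + C (coefLin a 2)]

/-- `linSubst` on `X₀`. [cite: Naie2007, §1.2 (normalization procedure) and Example 1] -/
@[simp] theorem linSubst_X0 : linSubst a dinv (X 0) =
    C dinv * (C (coefLin a 0) * (X 0 - C (coefLin a 2)) - C (coefLin a 1) * (X 1 - C (coefLin a 2))) := by
  simp [linSubst]
/-- `linSubst` on `X₁`. [cite: Naie2007, §1.2 (normalization procedure) and Example 1] -/
@[simp] theorem linSubst_X1 : linSubst a dinv (X 1) =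
    C dinv * (C (coefLin a 0) * (X 1 - C (coefLin a 2)) - C (coefLin a 1) * (X 0 - C (coefLin a 2))) := by
  simp [linSubst]
/-- `linSubstInv` on `X₀`. [cite: Naie2007, §1.2 (normalization procedure) and Example 1] -/
@[simp] theorem linSubstInv_X0 : linSubstInv a (X 0) = C (coefLin a 0) * X 0 + C (coefLin a 1) * X 1 + C (coefLin a 2) := by
  simp [linSubstInv]
/-- `linSubstInv` on `X₁`. [cite: Naie2007, §1.2 (normalization procedure) and Example 1] -/
@[simp] theorem linSubstInv_X1 : linSubstInv a (X 1) = C (coefLin a 1) * X 0 + C (coefLin a 0) * X 1 + C (coefLin a 2) := by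
  simp [linSubstInv]

/-- `linSubstInv ∘ linSubst = id` when `(a₀² − a₁²)·dinv = 1`. [cite: Naie2007, §1.2 (normalization procedure) and Example 1] -/
theorem linSubstInv_linSubst (hd : (coefLin a 0 ^ 2 - coefLin a 1 ^ 2) * dinv = 1) (p : MvPolynomial (Fin 2) R) :
    linSubstInv a (linSubst a dinv p) = p := by
  have hC : ((C (coefLin a 0) ^ 2 - C (coefLin a 1) ^ 2) * C dinv : MvPolynomial (Fin 2) R) = 1 := by
    rw [← map_pow, ← map_pow, ← map_sub, ← map_mul, hd, map_one]
  change ((linSubstInv a).comp (linSubst a dinv)) p = AlgHom.id R _ p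
  congr 1
  refine MvPolynomial.algHom_ext fun i => ?_
  fin_cases i
  · simp only [AlgHom.comp_apply, Fin.zero_eta, Fin.isValue, linSubst_X0, map_mul, map_sub, algHom_C,
      MvPolynomial.algebraMap_eq, linSubstInv_X0, linSubstInv_X1, AlgHom.id_apply]
    linear_combination (X 0) * hC
  · simp only [AlgHom.comp_apply, Fin.mk_one, Fin.isValue, linSubst_X1, map_mul, map_sub, algHom_C,
      MvPolynomial.algebraMap_eq, linSubstInv_X0, linSubstInv_X1, AlgHom.id_apply]
    linear_combination (X 1) * hC

/-- `linSubst` is injective when `(a₀² − a₁²)·dinv = 1`. [cite: Naie2007, §1.2 (normalization procedure) and Example 1] -/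
theorem linSubst_injective (hd : (coefLin a 0 ^ 2 - coefLin a 1 ^ 2) * dinv = 1) :
    Function.Injective (linSubst a dinv) :=
  Function.LeftInverse.injective (linSubstInv_linSubst a dinv hd)

/-- `u₀(s, y) = sqSubst (linSubst X₀)`. [cite: Naie2007, §1.2 (normalization procedure) and Example 1] -/
theorem sqSubst_linSubst_X0 : sqSubst R (linSubst a dinv (X 0)) = planeU₀₂ a dinv := by
  simp only [linSubst_X0, map_mul, map_sub, algHom_C, MvPolynomial.algebraMap_eq, sqSubst_X0, sqSubst_X1, planeU₀₂]

/-- `u₁(s, y) = sqSubst (linSubst X₁)`. [cite: Naie2007, §1.2 (normalization procedure) and Example 1] -/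
theorem sqSubst_linSubst_X1 : sqSubst R (linSubst a dinv (X 1)) = planeU₁₂ a dinv := by
  simp only [linSubst_X1, map_mul, map_sub, algHom_C, MvPolynomial.algebraMap_eq, sqSubst_X0, sqSubst_X1, planeU₁₂]

/-- **`Ψ₂ = sqSubst (linSubst (ψ(u₀, u₁, 1)))`.** [cite: Naie2007, §1.2 (normalization procedure) and Example 1] -/
theorem planeΨ₂_eq : planeΨ₂ a dinv = sqSubst R (linSubst a dinv (ψ₂ a)) := by
  have key : (aeval ![planeU₀₂ a dinv, planeU₁₂ a dinv, 1] : MvPolynomial (Fin 3) R →ₐ[R] MvPolynomial (Fin 2) R) =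
      ((sqSubst R).comp (linSubst a dinv)).comp dehom₂ := by
    refine MvPolynomial.algHom_ext fun i => ?_
    fin_cases i
    · simp [dehom₂, planeU₀₂]
    · simp [dehom₂, planeU₁₂]
    · simp [dehom₂]
  rw [planeΨ₂, key, ψ₂]
  rfl

/-- **`Ψ₂ ≠ 0` as soon as `ψ(u₀, u₁, 1) ≠ 0`** (and `(a₀² − a₁²)·dinv = 1`). [cite: Naie2007, §1.2 (normalization procedure) and Example 1] -/
theorem planeΨ₂_ne_zero (hd : (coefLin a 0 ^ 2 - coefLin a 1 ^ 2) * dinv = 1) (hψ : ψ₂ a ≠ 0) :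
    planeΨ₂ a dinv ≠ 0 := by
  rw [planeΨ₂_eq]
  intro h
  apply hψ
  apply linSubst_injective a dinv hd
  apply sqSubst_injective
  rw [h, map_zero, map_zero]

end Lin

/-! ### The conclusions under tree-vocabulary hypotheses -/

section Conclusions

variable {R : Type v} [CommRing R] [IsDomain R] {e : ℕ} (a : CIdx e → R) (dinv : R)
  (hd : (coefLin a 0 ^ 2 - coefLin a 1 ^ 2) * dinv = 1) (hdinv : dinv ≠ 0)
  (h01 : coefLin a 0 + coefLin a 1 ≠ 0) (hψ : ψ₂ a ≠ 0)
include hd hdinv h01 hψ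

/-- **`h̄` is a non-zero-divisor of the double-plane chart ring** for `R` a domain, `a₀² − a₁²` invertible (`dinv`),
`a₀ + a₁ ≠ 0` and `ψ(u₀, u₁, 1) ≠ 0`. [cite: AtiyahMacdonald1969, Prop. 3.9 and Ex. 3.7] [cite: Zariski1929] -/
theorem hBar_mem_nonZeroDivisors' : hBar a ∈ nonZeroDivisors (DoublePlaneRing a) :=
  hBar_mem_nonZeroDivisors a dinv hd (planeH₂_ne_zero a dinv hdinv h01 (planeΨ₂_ne_zero a dinv hd hψ))

/-- **The double-plane chart ring is a domain** (same hypotheses, and the deck ring a domain — the tree's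
`isDomain_deckRing_of_injective`). [cite: AtiyahMacdonald1969, Prop. 3.9 and Ex. 3.7] -/
theorem isDomain_doublePlaneRing' [IsDomain (DeckRing a)] : IsDomain (DoublePlaneRing a) :=
  isDomain_doublePlaneRing a dinv hd (planeH₂_ne_zero a dinv hdinv h01 (planeΨ₂_ne_zero a dinv hd hψ))

/-- **`Spec (DeckRing a)` and `Spec (DoublePlaneRing a)` are birational over `Spec R`** (same hypotheses).
[cite: GortzWedhorn2020, Prop. 4.32 (2)] -/
theorem birationalOver_spec_doublePlane' [IsDomain (DeckRing a)] :
    Scheme.BirationalOver (Spec.map (CommRingCat.ofHom (algebraMap R (DeckRing a))))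
      (Spec.map (CommRingCat.ofHom (algebraMap R (DoublePlaneRing a)))) :=
  birationalOver_spec_doublePlane a dinv hd (planeH₂_ne_zero a dinv hdinv h01 (planeΨ₂_ne_zero a dinv hd hψ))

end Conclusions

end Literature.AlgebraicGeometry.HodgeTheory.Q8Family

end
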